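import Summits.QuantumAdvantage.QuantumAdvantage.Cruxes.PureCubicClassNumberHard.Disproof
import Summits.QuantumAdvantage.QuantumAdvantage.Cruxes.PureCubicClassGroupFBQP.Disproof
import Summits.QuantumAdvantage.QuantumAdvantage.Cruxes.PureCubicClassNumberHard.StrategistReExam
import Summits.QuantumAdvantage.QuantumAdvantage.Theorems.LinnikCubicClassGroupsPureCubicClassGroupFBQPStubClassStageAssembly

/-!
# `Lines/JuntaLadder.lean` — line `JuntaLadder` on crux `PureCubicClassNumberHard` (stmt-QuantumAdvantage-11826)

Forward generator G4 (ladder-down), unit `fwd-ladder-QuantumAdvantage-50`.  ONE SELF-CONTAINED MODULE in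
three parts (the farm builds new crux-workfile modules with a multi-hour lag, so the line could not import a
freshly written sibling module this session; the earlier `Cruxes/PureCubicClassNumberHard/LadderDown.lean`
is superseded by PART I below and has been reduced to a pointer — same declaration names, namespace
`…Cruxes.PureCubicClassNumberHard.LadderDown`, so nothing downstream changes):

* PART I  (namespace `…Cruxes.PureCubicClassNumberHard.LadderDown`) — the rung families below the crux in
  its own language: `JuntaRung j` (floor `j = 0` PROVED: `juntaRung_zero`; `FiftyBlindBitsRung`,
  `OneBlindBitRung`; `juntaRung_id_iff : JuntaRung id ↔ crux`) and `CalibrationRung H` (floor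
  `PhiHidingThree`; `RSACalibration`).
* PART II (namespace `…Cruxes.PureCubicClassNumberHard.JuntaLadder`) — THE LINE: stubs `stub_genus` (L),
  `stub_reach` (M), `stub_climb` (crux-strength, frontier), the kernel-checked reduction
  `fiftyBlindBitsRung_of_stubs` and the composition `PureCubicClassNumberHard_of` concluding the crux by name.
* PART III (namespace `…JuntaLadder.Special`) — the compiled witnesses (`special_file` of the forward
  generator): floor proved, rung specialises to floor, on-path lemmas.  No `sorry` outside PART II's stubs.
-/

/-!
# PART I — `LadderDown`: the graded families BELOW `PureCubicClassNumberHard` (`X`, stmt-QuantumAdvantage-11826)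

Forward generator G4 (ladder-down), unit `fwd-ladder-QuantumAdvantage-50`.  `X` is the worst-case
classical-hardness hypothesis "no PPT algorithm prints the `2|x|+8` low bits of `h(ℚ(∛m))` on every
non-cube `m`" (normal form `crux_iff_targetBits_hard`).  This file TYPES the two gradations of `X`
that carry a PROVED floor, in `X`'s own language, and proves what is cheap:

* **Family D (information-restricted adversaries) — `JuntaRung j`**: every PPT algorithm whose
  output law at length `n` depends on at most `j n` (adversarially placed) input positions fails at
  arbitrarily large lengths.  Antitone in `j`.  TOP `j = id` is literally `X`
  (`juntaRung_id_iff`, via the disprover's `crux_iff_infinitely_many_lengths`); ON-PATH `X → JuntaRung j`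
  for every `j` (`juntaRung_of_crux`); FLOOR `j = 0` (length-oblivious laws) is PROVED here sorry-free
  (`juntaRung_zero`) from the landed `h = 1` for cubic fields `∋ ∛2` and `h ≠ 1` for cubic fields
  `∋ ∛7` at the equal-length radicands `54·8^k`, `56·8^k`; NEXT RUNGS `FiftyBlindBitsRung`
  (`j n = n - 50`: Dirichlet + `honda25` + a GENERAL genus lemma + subset sums mod 49) and
  `OneBlindBitRung` (`j n = n - 1`: an upper-bound sieve) are typed, not proved.  CEILING: `n - 1`;
  the step `n - 1 → n` is all of `X` (the family is information-theoretic, `X` is computational).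
* **Family A (conditional calibration) — `CalibrationRung H := H → X`**: FLOOR `H = PhiHidingThree`
  is the landed `pureCubicClassNumberHard_of_phiHidingThree`; NEXT `RSACalibration`
  (`H = RSASplitHard ∧ DegreeOnePrimesEscape`, the ramified-cubes transfer, census D2) is typed;
  its leaf implies the summit on its own (`ReExam.factoringType_leaf`), so it is banked, not lined.

Nothing here concludes the summit; no decl of this file is a route item.
-/

namespace Summit.QuantumAdvantage.QuantumAdvantage.Cruxes.PureCubicClassNumberHard.LadderDown

open Literature.Computability.Complexity _root_.Computability
open Summit.QuantumAdvantage.QuantumAdvantage.Theses.LinnikCubicClassGroups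
  (PureCubicClassNumberHard DegreeOnePrimesEscape)
open Summit.QuantumAdvantage.QuantumAdvantage.Cruxes.PureCubicClassNumberHard.Disproof
  (targetBits bitsOf targetBits_eq crux_iff_targetBits_hard crux_iff_infinitely_many_lengths
    pr_add_pr_le_one nonempty_admissible)
open Summit.QuantumAdvantage.QuantumAdvantage.Cruxes.PureCubicClassGroupFBQP.Disproof
  (classNumber_eq_one_of_cbrt_two classNumber_ne_one_of_cbrt_seven eq_of_testBit_eq_of_lt)
open Summit.QuantumAdvantage.QuantumAdvantage.Theorems.LinnikCubicClassGroups (classNumber_lt_window)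
open Summit.QuantumAdvantage.QuantumAdvantage.Theorems
  (PhiHidingThree pureCubicClassNumberHard_of_phiHidingThree)
open Summit.QuantumAdvantage.QuantumAdvantage.Cruxes.PureCubicClassNumberHard.ReExam
  (RSASplitHard)

/-! ## Family D: the junta ladder -/

/-- `A`'s output law at inputs of length `n` depends only on the input bits at the positions `J n`. -/
def IsBlindOff (A : RandAlg (List Bool) (List Bool)) (J : ℕ → Finset ℕ) : Prop :=
  ∀ x x' : List Bool, x.length = x'.length → (∀ i ∈ J x.length, x[i]? = x'[i]?) →
    ∀ E : Set (List Bool), A.pr id x E = A.pr id x' E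

/-- **RUNG FAMILY** `JuntaRung j`: every PPT algorithm reading (in law) at most `j n` adversarially
placed bit positions of an `n`-bit input fails — on some non-cube input of length `≥ n₀`, for every
`n₀` — to print the class-number window `targetBits`. -/
def JuntaRung (j : ℕ → ℕ) : Prop :=
  ∀ A : RandAlg (List Bool) (List Bool), A.IsPolyTime id id →
    ∀ J : ℕ → Finset ℕ, (∀ n, (J n).card ≤ j n) → IsBlindOff A J →
      ∀ n₀ : ℕ, ∃ x : List Bool, n₀ ≤ x.length ∧ (∀ r : ℕ, r ^ 3 ≠ decodeNat x) ∧
        A.pr id x {targetBits x} < 2 / 3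

/-- The family is antitone in the junta bound. -/
theorem juntaRung_anti {j j' : ℕ → ℕ} (hle : ∀ n, j n ≤ j' n) (h : JuntaRung j') : JuntaRung j :=
  fun A hA J hJ hB n₀ => h A hA J (fun n => (hJ n).trans (hle n)) hB n₀

/-- **ON-PATH**: the crux implies every rung (drop the junta hypothesis; `X` in its
"infinitely many lengths" form, `crux_iff_infinitely_many_lengths`). -/
theorem juntaRung_of_crux (j : ℕ → ℕ) (hX : PureCubicClassNumberHard) : JuntaRung j := by
  intro A hA J _ _ n₀
  have hinf := (crux_iff_infinitely_many_lengths.mp hX) A hA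
  obtain ⟨n, hn, hn₀⟩ := hinf.exists_gt n₀
  obtain ⟨x, hxn, hm, hlt⟩ := hn
  exact ⟨x, by omega, hm, hlt⟩

/-- Reading every position is no restriction. -/
theorem isBlindOff_range (A : RandAlg (List Bool) (List Bool)) :
    IsBlindOff A (fun n => Finset.range n) := by
  intro x x' hlen hJ E
  have hxx' : x = x' := List.ext_getElem? fun i => by
    by_cases hi : i < x.length
    · exact hJ i (Finset.mem_range.mpr hi)
    · rw [List.getElem?_eq_none_iff.mpr (by omega), List.getElem?_eq_none_iff.mpr (by omega)]
  rw [hxx']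

/-- **TOP = `X`**: with `j = id` the rung IS the crux (normal form `crux_iff_targetBits_hard`).  Stated as
an `Iff` on purpose: the skeleton checker takes a theorem of the module CONCLUDING the crux (head symbol) as the
line's composition, and that must be PART II's `JuntaLadder.PureCubicClassNumberHard_of` alone; use `juntaRung_id_iff.mp`
for the arrow form (no separate theorem, so that the composition stays the only crux-concluding declaration). -/
theorem juntaRung_id_iff : JuntaRung (fun n => n) ↔ PureCubicClassNumberHard := by
  refine ⟨fun h => ?_, juntaRung_of_crux _⟩
  rw [crux_iff_targetBits_hard]
  rintro ⟨A, hA, hcorr⟩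
  obtain ⟨x, -, hm, hlt⟩ :=
    h A hA (fun n => Finset.range n) (fun n => by simp) (isBlindOff_range A) 0
  exact (not_lt.mpr (hcorr x hm)) hlt

/-! ### The floor `j = 0`, proved: equal-length radicands `54·8^k = 2·(3·2^k)³` and `56·8^k = 7·(2^(k+1))³` -/

/-- Inputs decoding to `54 · 8^k` (a cubic field `∋ ∛(54·8^k)` contains `∛2`: `h = 1`). -/
def x54 (k : ℕ) : List Bool := List.replicate (3 * k) false ++ [false, true, true, false, true, true]

/-- Inputs decoding to `56 · 8^k` (a cubic field `∋ ∛(56·8^k)` contains `∛7`: `h ≠ 1`). -/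
def x56 (k : ℕ) : List Bool := List.replicate (3 * k) false ++ [false, false, false, true, true, true]

theorem length_x54 (k : ℕ) : (x54 k).length = 3 * k + 6 := by simp [x54]

theorem length_x56 (k : ℕ) : (x56 k).length = 3 * k + 6 := by simp [x56]

theorem decodePosNum_replicate_false_append (L : ℕ) (l : List Bool) :
    ((decodePosNum (List.replicate L false ++ l) : PosNum) : ℕ) = 2 ^ L * (decodePosNum l : ℕ) := by
  induction L with
  | zero => simp
  | succ L ih =>
    rw [List.replicate_succ, List.cons_append, decodePosNum, PosNum.cast_bit0, ih]
    ring

/-- Prepending `L` zeros (low bits) multiplies the decoded value by `2^L`. -/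
theorem decodeNat_replicate_false_append (L : ℕ) {l : List Bool} (hl : l ≠ []) :
    decodeNat (List.replicate L false ++ l) = 2 ^ L * decodeNat l := by
  have hne : List.replicate L false ++ l ≠ [] := by simp [hl]
  have h : decodeNum (List.replicate L false ++ l)
      = Num.pos (decodePosNum (List.replicate L false ++ l)) := by
    simp [decodeNum, hne]
  have h' : decodeNum l = Num.pos (decodePosNum l) := by simp [decodeNum, hl]
  show ((decodeNum (List.replicate L false ++ l) : Num) : ℕ) = 2 ^ L * ((decodeNum l : Num) : ℕ)
  rw [h, h']
  exact decodePosNum_replicate_false_append L l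

theorem decodeNat_x54 (k : ℕ) : decodeNat (x54 k) = 54 * 2 ^ (3 * k) := by
  rw [x54, decodeNat_replicate_false_append _ (by simp),
    show decodeNat [false, true, true, false, true, true] = 54 by decide, Nat.mul_comm]

theorem decodeNat_x56 (k : ℕ) : decodeNat (x56 k) = 56 * 2 ^ (3 * k) := by
  rw [x56, decodeNat_replicate_false_append _ (by simp),
    show decodeNat [false, false, false, true, true, true] = 56 by decide, Nat.mul_comm]

/-- `p · d³` is not a cube (`p` prime, `d ≠ 0`): compare `p`-adic valuations mod `3`. -/
theorem not_cube_of_prime_mul_cube {p d : ℕ} (hp : p.Prime) (hd : d ≠ 0) :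
    ∀ r : ℕ, r ^ 3 ≠ p * d ^ 3 := by
  intro r hr
  haveI := Fact.mk hp
  have hr0 : r ≠ 0 := by
    rintro rfl
    have : p * d ^ 3 ≠ 0 := Nat.mul_ne_zero hp.ne_zero (pow_ne_zero 3 hd)
    omega
  have hv := congrArg (padicValNat p) hr
  rw [padicValNat.pow r 3, padicValNat.mul hp.ne_zero (pow_ne_zero 3 hd), padicValNat.pow d 3,
    padicValNat_self] at hv
  omega

theorem x54_eq (k : ℕ) : 54 * 2 ^ (3 * k) = 2 * (3 * 2 ^ k) ^ 3 := by
  rw [mul_pow, ← pow_mul, Nat.mul_comm k 3]; ring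

theorem x56_eq (k : ℕ) : 56 * 2 ^ (3 * k) = 7 * (2 * 2 ^ k) ^ 3 := by
  rw [mul_pow, ← pow_mul, Nat.mul_comm k 3]; ring

theorem not_cube_x54 (k : ℕ) : ∀ r : ℕ, r ^ 3 ≠ decodeNat (x54 k) := by
  rw [decodeNat_x54, x54_eq]
  exact not_cube_of_prime_mul_cube Nat.prime_two (by positivity)

theorem not_cube_x56 (k : ℕ) : ∀ r : ℕ, r ^ 3 ≠ decodeNat (x56 k) := by
  rw [decodeNat_x56, x56_eq]
  exact not_cube_of_prime_mul_cube (by norm_num) (by positivity)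

/-- A field with a cube root of `54·8^k` has a cube root of `2`. -/
theorem exists_cbrt_two_of_x54 {K : Type} [Field K] [NumberField K] {k : ℕ}
    (hα : ∃ α : K, α ^ 3 = (decodeNat (x54 k) : K)) : ∃ β : K, β ^ 3 = 2 := by
  obtain ⟨α, hα⟩ := hα
  rw [decodeNat_x54, x54_eq] at hα
  have hc : ((3 * 2 ^ k : ℕ) : K) ≠ 0 := Nat.cast_ne_zero.mpr (by positivity)
  refine ⟨α / ((3 * 2 ^ k : ℕ) : K), ?_⟩
  rw [div_pow, hα, div_eq_iff (pow_ne_zero 3 hc)]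
  push_cast
  ring

/-- A field with a cube root of `56·8^k` has a cube root of `7`. -/
theorem exists_cbrt_seven_of_x56 {K : Type} [Field K] [NumberField K] {k : ℕ}
    (hα : ∃ α : K, α ^ 3 = (decodeNat (x56 k) : K)) : ∃ β : K, β ^ 3 = 7 := by
  obtain ⟨α, hα⟩ := hα
  rw [decodeNat_x56, x56_eq] at hα
  have hc : ((2 * 2 ^ k : ℕ) : K) ≠ 0 := Nat.cast_ne_zero.mpr (by positivity)
  refine ⟨α / ((2 * 2 ^ k : ℕ) : K), ?_⟩
  rw [div_pow, hα, div_eq_iff (pow_ne_zero 3 hc)]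
  push_cast
  ring

theorem bitsOf_eq_of_length_eq {x x' : List Bool} (h : x.length = x'.length) (n : ℕ) :
    bitsOf x n = bitsOf x' n := by
  unfold bitsOf; rw [h]

/-- The target at `x54 k` is `1` in `6k+20` bits. -/
theorem targetBits_x54 (k : ℕ) : targetBits (x54 k) = bitsOf (x54 k) 1 := by
  obtain ⟨⟨K, h3, hα⟩⟩ := nonempty_admissible (not_cube_x54 k)
  obtain ⟨β, hβ⟩ := exists_cbrt_two_of_x54 hα
  rw [targetBits_eq (x54 k) (not_cube_x54 k) K h3 hα, classNumber_eq_one_of_cbrt_two h3 hβ]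

/-- **The two equal-length targets differ** (`h = 1` vs `h ≠ 1`, inside the `2|x|+8`-bit window). -/
theorem targetBits_x54_ne_x56 (k : ℕ) : targetBits (x54 k) ≠ targetBits (x56 k) := by
  obtain ⟨⟨K', h3', hα'⟩⟩ := nonempty_admissible (not_cube_x56 k)
  obtain ⟨γ, hγ⟩ := exists_cbrt_seven_of_x56 hα'
  have hlen : (x54 k).length = (x56 k).length := by rw [length_x54, length_x56]
  rw [targetBits_x54, targetBits_eq (x56 k) (not_cube_x56 k) K' h3' hα',
    bitsOf_eq_of_length_eq hlen]
  intro h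
  have hlt := classNumber_lt_window (x56 k) K' h3' (not_cube_x56 k) hα'
  have h1 : (1 : ℕ) < 2 ^ (2 * (x56 k).length + 8) := Nat.one_lt_two_pow (by omega)
  unfold bitsOf at h
  exact classNumber_ne_one_of_cbrt_seven h3' hγ
    (eq_of_testBit_eq_of_lt h1 hlt (List.ofFn_injective h)).symm

/-- **FLOOR, proved (`θ₀ = 0`)**: a PPT algorithm whose output law depends only on the input
LENGTH fails at arbitrarily large lengths — at length `3k+6` the non-cube inputs `x54 k`, `x56 k`
demand different strings from the same law (`pr_add_pr_le_one`). -/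
theorem juntaRung_zero : JuntaRung (fun _ => 0) := by
  intro A _ J hJ hB n₀
  have hJe : ∀ n, J n = ∅ := fun n => Finset.card_eq_zero.mp (Nat.le_zero.mp (hJ n))
  have hlen : (x54 n₀).length = (x56 n₀).length := by rw [length_x54, length_x56]
  have hbl : ∀ E, A.pr id (x54 n₀) E = A.pr id (x56 n₀) E :=
    hB _ _ hlen (fun i hi => by simp [hJe] at hi)
  by_cases h54 : A.pr id (x54 n₀) {targetBits (x54 n₀)} < 2 / 3
  · exact ⟨x54 n₀, by rw [length_x54]; omega, not_cube_x54 n₀, h54⟩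
  · refine ⟨x56 n₀, by rw [length_x56]; omega, not_cube_x56 n₀, ?_⟩
    have hsum := pr_add_pr_le_one A (x54 n₀) (targetBits_x54_ne_x56 n₀)
    rw [← hbl]
    have h54' := not_lt.mp h54
    linarith

/-! ### The next rungs (typed, not proved) and the top -/

/-- **NEXT RUNG `θ₁`**: algorithms blind (in law) to at least `50` adversarially chosen positions
fail at arbitrarily large lengths.  Route to a proof: at lengths `n = |enc(2q)|`, `q ≡ 5 (mod 9)`
prime (Dirichlet, Mathlib `Nat.setOf_prime_and_eq_mod_infinite`), `3 ∤ h(ℚ(∛(2q)))` (`honda25`);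
moving `≤ 48` blind bits reaches `m'` with `7 ∥ m'` (subset sums of units cover `ℤ/49`), and
`3 ∣ h(ℚ(∛m'))` needs the genus lemma for a GENERAL radicand with `v₇(m') = 1` (tree: `m = pq` only,
`Honda1971.three_dvd_classNumber_of_mod_three_eq_one`); the window `classNumber_lt_window` separates. -/
def FiftyBlindBitsRung : Prop := JuntaRung (fun n => n - 50)

/-- **RUNG `θ₂`** (horizon of the family): blind to ONE adversarial position.  Needs an upper-bound
sieve: primes `q ≡ 5 (9)` with `2q ± 2^i` free of primes `≡ 1 (mod 3)` to the first power are
`o(π(x; 9, 5))`.  Above `θ₂` the family has only `j = id`, i.e. `X` itself. -/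
def OneBlindBitRung : Prop := JuntaRung (fun n => n - 1)

theorem fiftyBlindBitsRung_of_crux (h : PureCubicClassNumberHard) : FiftyBlindBitsRung :=
  juntaRung_of_crux _ h

theorem oneBlindBitRung_of_crux (h : PureCubicClassNumberHard) : OneBlindBitRung :=
  juntaRung_of_crux _ h

theorem fiftyBlindBitsRung_of_oneBlindBitRung (h : OneBlindBitRung) : FiftyBlindBitsRung :=
  juntaRung_anti (fun n => by omega) h

theorem juntaRung_zero_of_fiftyBlindBitsRung (h : FiftyBlindBitsRung) : JuntaRung (fun _ => 0) :=
  juntaRung_anti (fun _ => Nat.zero_le _) h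

end Summit.QuantumAdvantage.QuantumAdvantage.Cruxes.PureCubicClassNumberHard.LadderDown

/-!
# PART II — line `JuntaLadder`: crux `PureCubicClassNumberHard` (stmt-QuantumAdvantage-11826) via the junta ladder

Forward generator G4 (ladder-down), unit `fwd-ladder-QuantumAdvantage-50`.  DISPOSITION: **frontier**.

The rung family `LadderDown.JuntaRung j` (floor `j = 0` PROVED: `LadderDown.juntaRung_zero`; top
`j = id` ↔ the crux: `LadderDown.juntaRung_id_iff`).  This skeleton files the NEXT RUNG
`LadderDown.FiftyBlindBitsRung = JuntaRung (fun n => n - 50)` — every PPT algorithm whose output law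
ignores ≥ 50 adversarially placed input positions fails, at arbitrarily large lengths, to print the
class-number window of `ℚ(∛m)` — and REDUCES IT, kernel-checked (`fiftyBlindBitsRung_of_stubs`), to two
arithmetic stubs:

* `stub_genus`  (L) — genus theory for a GENERAL radicand: a prime `ℓ ≡ 1 (mod 3)` with `ℓ ∥ m` forces
  `3 ∣ h(K)` for every cubic `K ∋ ∛m` (genus theory: bib `Ishida1976` Ch. 7 Thm 7 / eq. (7.7),
  `BarrucandCohn1970`, `Honda1971` §1, total ramification `Cohen1993` Cor. 6.4.15; the tree proves the case
  `m = pq` only: `Literature.…Honda1971.three_dvd_classNumber_of_prime_mod_three` — same proof with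
  `e(ℓ, K) = 3` from `ℓ ∥ m`);
* `stub_reach`  (M) — bit-flip reachability: flipping a subset of any `48` free non-top positions of
  `encodeNat m` reaches a value `≡ 7 (mod 49)` (subset sums of ≥ 48 units of `ℤ/49` cover `ℤ/49`);

plus the proved inputs `honda25` (`3 ∤ h(ℚ(∛(2q)))`, `q ≡ 5 (mod 9)`), Dirichlet
(`Nat.forall_exists_prime_gt_and_eq_mod`), the window `classNumber_lt_window` and `pr_add_pr_le_one`.

* `stub_climb : FiftyBlindBitsRung → JuntaRung (fun n => n)` is the CLIMB TO THE TOP of the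
  family (`JuntaRung id ↔` the crux) and is **crux-strength** (given the rung it is the crux: the family is information-theoretic,
  its ceiling is `j n = n - 1` = `LadderDown.OneBlindBitRung`, and the step to `j = id` is a worst-case
  lower bound against all PPT algorithms, `⇒ P ≠ PSPACE` by `Disproof.P_ne_PSPACE_of_crux_and_quantum_half`).
  It is typed so that the composition concludes the crux BY NAME; it is NOT offered as provable
  (census `STRATEGY-CENSUS.md` §E46: no decomposition of the crux).  Bankable content = the rung.

FORWARD: generator=ladder ; seed=g4b-QuantumAdvantage-11826 ; rung_decl=…LadderDown.FiftyBlindBitsRung ;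
witness=…LadderDown.juntaRung_zero ; special_file=Lines/JuntaLadder.lean (PART III, namespace JuntaLadder.Special) ; step=parameter: junta
bound j from 0 to n-50 ; gap_after=j = n-1 (sieve), then j = id = the crux ; method_family=fooling pairs
for information-restricted adversaries + genus theory ; ladder_ceiling=capped-at-(n-1 blind bits) ;
ceiling_lift=none ; disposition=frontier ; residual=none.
-/

namespace Summit.QuantumAdvantage.QuantumAdvantage.Cruxes.PureCubicClassNumberHard.JuntaLadder

open Literature.Computability.Complexity _root_.Computability
open Summit.QuantumAdvantage.QuantumAdvantage.Theses.LinnikCubicClassGroups (PureCubicClassNumberHard)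
open Summit.QuantumAdvantage.QuantumAdvantage.Cruxes.PureCubicClassNumberHard.Disproof
  (targetBits bitsOf targetBits_eq pr_add_pr_le_one nonempty_admissible)
open Summit.QuantumAdvantage.QuantumAdvantage.Cruxes.PureCubicClassGroupFBQP.Disproof
  (eq_of_testBit_eq_of_lt)
open Summit.QuantumAdvantage.QuantumAdvantage.Theorems.LinnikCubicClassGroups
  (classNumber_lt_window honda25 lt_two_pow_of_size_le)
open Summit.QuantumAdvantage.QuantumAdvantage.Cruxes.PureCubicClassNumberHard.LadderDown
  (IsBlindOff JuntaRung FiftyBlindBitsRung bitsOf_eq_of_length_eq juntaRung_id_iff)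

/-- Statement of `stub_genus`: genus theory for pure cubic fields with a GENERAL radicand — a prime
`ℓ ≡ 1 (mod 3)` dividing `m` exactly once makes `3 ∣ h(K)` for every cubic number field `K ∋ ∛m`. -/
def GenusLemma : Prop :=
  ∀ (ℓ m : ℕ), ℓ.Prime → ℓ % 3 = 1 → padicValNat ℓ m = 1 →
    ∀ (K : Type) [Field K] [NumberField K], Module.finrank ℚ K = 3 →
      ∀ α : K, α ^ 3 = (m : K) → 3 ∣ NumberField.classNumber K

/-- Statement of `stub_reach`: from `encodeNat m` (`m > 0`), changing bits only inside a set `F` of at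
least `48` non-top positions reaches an input of the same length decoding to `≡ 7 (mod 49)`. -/
def ReachSevenMod49 : Prop :=
  ∀ (m : ℕ) (F : Finset ℕ), 0 < m → F ⊆ Finset.range ((encodeNat m).length - 1) → 48 ≤ F.card →
    ∃ x' : List Bool, x'.length = (encodeNat m).length ∧
      (∀ i : ℕ, i ∉ F → x'[i]? = (encodeNat m)[i]?) ∧ decodeNat x' % 49 = 7

/-- STUB (L): genus theory, general radicand (adapt `Honda1971.three_dvd_classNumber_of_prime_mod_three`:
`ℓ ∥ m ⇒ e(ℓ, K) = 3`, cubic subfield of `ℚ(ζ_ℓ)`, Abhyankar, Cox Cor. 5.24).  Sources: bib `Ishida1976`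
(LNM 555) Ch. 7 Thm 7 / eq. (7.7) (genus number `g_K = ∏_{p ∣ a, p ∤ n} (n, p - 1)` of `ℚ(ⁿ√a)`, `n` odd),
`BarrucandCohn1970`, `Honda1971`; `Cohen1993` Cor. 6.4.15 (`ℓ ∣ a ⇒ ℓ` totally ramified). -/
theorem stub_genus : GenusLemma := by
  sorry

/-- STUB (M): subset sums of `≥ 48` units cover `ℤ/49`, transported through `encodeNat`/`decodeNat`. -/
theorem stub_reach : ReachSevenMod49 := by
  sorry

/-- STUB (crux-strength, FRONTIER): the CLIMB from `j(n) = n - 50` to the top `j = id` of the junta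
family.  Given the rung this is the crux (`LadderDown.juntaRung_id_iff`); it is typed so that the
composition concludes the crux by name and is NOT offered as provable (see header). -/
theorem stub_climb : FiftyBlindBitsRung → JuntaRung (fun n => n) := by
  sorry

/-- Statement of `stub_climb` (verbatim). -/
abbrev ClimbStmt : Prop := FiftyBlindBitsRung → JuntaRung (fun n => n)

/-! ### Name-keyed aliases of the stub statements (skeleton-checker convention: the composition's
hypotheses must be headed by the registered stub names; cf. `Cruxes/AAConj/Lines/average_and_clip.lean`). -/
namespace Registered

/-- Alias of `stub_genus`'s statement keyed by the registered stub name. -/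
abbrev stub_genus : Prop := GenusLemma
/-- Alias of `stub_reach`'s statement keyed by the registered stub name. -/
abbrev stub_reach : Prop := ReachSevenMod49
/-- Alias of `stub_climb`'s statement keyed by the registered stub name. -/
abbrev stub_climb : Prop := ClimbStmt

end Registered

/-! ## The rung from the two arithmetic stubs (proved) -/

theorem not_cube_of_padicValNat_eq_one {p m : ℕ} (hp : p.Prime) (h : padicValNat p m = 1) :
    ∀ r : ℕ, r ^ 3 ≠ m := by
  intro r hr
  haveI := Fact.mk hp
  have hv := congrArg (padicValNat p) hr
  rw [padicValNat.pow r 3, h] at hv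
  omega

theorem padicValNat_seven_of_mod {m : ℕ} (h : m % 49 = 7) : padicValNat 7 m = 1 := by
  haveI := Fact.mk (by norm_num : Nat.Prime 7)
  have hm0 : m ≠ 0 := by rintro rfl; simp at h
  have h7 : 7 ∣ m := by omega
  have h49 : ¬ 7 ^ 2 ∣ m := by norm_num; omega
  have h1 : 1 ≤ padicValNat 7 m := one_le_padicValNat_of_dvd hm0 h7
  have h2 : ¬ 2 ≤ padicValNat 7 m := by rwa [← padicValNat_dvd_iff_le hm0]
  omega

/-- **The rung, reduced to arithmetic.**  Dirichlet gives a prime `q ≡ 5 (mod 9)` as large as we like;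
`x = encodeNat (2q)` has `3 ∤ h` (`honda25`); the `≥ 49` free non-top positions let us move to `x'` of
the same length, agreeing with `x` on the read positions, with `decodeNat x' ≡ 7 (mod 49)`, whence
`7 ∥ decodeNat x'`, a non-cube with `3 ∣ h` (`GenusLemma`); the window separates the two targets and a
blind algorithm has the same law on both. -/
theorem fiftyBlindBitsRung_of_stubs (hg : GenusLemma) (hr : ReachSevenMod49) : FiftyBlindBitsRung := by
  intro A _ J hJ hB n₀
  -- a prime q ≡ 5 (mod 9) beyond 2 ^ (n₀ + 60)
  have h5 : IsUnit (5 : ZMod 9) := IsUnit.of_mul_eq_one (2 : ZMod 9) (by decide)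
  obtain ⟨q, hqgt, hq, hq9⟩ := Nat.forall_exists_prime_gt_and_eq_mod h5 (2 ^ (n₀ + 60))
  have hq9' : q % 9 = 5 := by
    have hv := congrArg ZMod.val hq9
    rwa [ZMod.val_natCast] at hv
  have hxm : decodeNat (encodeNat (2 * q)) = 2 * q := decode_encodeNat _
  -- its encoding is long
  have hlen : n₀ + 59 ≤ (encodeNat (2 * q)).length := by
    by_contra hlt
    have h1 : 2 * q < 2 ^ (n₀ + 58 + 1) := lt_two_pow_of_size_le (by omega)
    have h2 : 2 ^ (n₀ + 58 + 1) ≤ 2 ^ (n₀ + 60) := Nat.pow_le_pow_right (by norm_num) (by omega)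
    omega
  -- at least 49 free non-top positions
  have hFcard : 48 ≤ (Finset.range ((encodeNat (2 * q)).length - 1) \
      J (encodeNat (2 * q)).length).card := by
    have h1 := Finset.card_le_card_sdiff_add_card (s := Finset.range ((encodeNat (2 * q)).length - 1))
      (t := J (encodeNat (2 * q)).length)
    have h2 : (J (encodeNat (2 * q)).length).card ≤ (encodeNat (2 * q)).length - 50 := hJ _
    simp only [Finset.card_range] at h1
    omega
  obtain ⟨x', hlen', hagree, hmod⟩ :=
    hr (2 * q) _ (by have := hq.pos; omega) Finset.sdiff_subset hFcard
  -- a blind algorithm has the same output law on both inputs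
  have hbl : ∀ E, A.pr id (encodeNat (2 * q)) E = A.pr id x' E := by
    refine hB _ _ hlen'.symm (fun i hi => ?_)
    exact (hagree i (fun hiF => (Finset.mem_sdiff.mp hiF).2 hi)).symm
  -- both inputs are non-cubes
  haveI : Fact (Nat.Prime 2) := ⟨Nat.prime_two⟩
  haveI : Fact q.Prime := ⟨hq⟩
  have hq2 : (2 : ℕ) ≠ q := by omega
  have hv2 : padicValNat 2 (2 * q) = 1 := by
    rw [padicValNat.mul (by norm_num) hq.ne_zero, padicValNat_self, padicValNat_primes hq2]
  have hm_nc : ∀ r : ℕ, r ^ 3 ≠ decodeNat (encodeNat (2 * q)) := by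
    rw [hxm]; exact not_cube_of_padicValNat_eq_one Nat.prime_two hv2
  have hv7 : padicValNat 7 (decodeNat x') = 1 := padicValNat_seven_of_mod hmod
  have hm'_nc : ∀ r : ℕ, r ^ 3 ≠ decodeNat x' := not_cube_of_padicValNat_eq_one (by norm_num) hv7
  -- the fields: 3 ∤ h on the first (Honda), 3 ∣ h on the second (genus at 7)
  obtain ⟨⟨K, h3, hα⟩⟩ := nonempty_admissible hm_nc
  obtain ⟨⟨K', h3', hα'⟩⟩ := nonempty_admissible hm'_nc
  have hK : ¬ 3 ∣ NumberField.classNumber K := by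
    refine honda25 2 q Nat.prime_two hq (by norm_num) hq9' K h3 ?_
    obtain ⟨α, hα⟩ := hα
    exact ⟨α, by rw [hα, hxm]⟩
  have hK' : 3 ∣ NumberField.classNumber K' := by
    obtain ⟨α', hα'⟩ := hα'
    exact hg 7 (decodeNat x') (by norm_num) (by norm_num) hv7 K' h3' α' hα'
  have hne : NumberField.classNumber K ≠ NumberField.classNumber K' := fun h => hK (h ▸ hK')
  -- so the two targets differ inside the window
  have hT : targetBits (encodeNat (2 * q)) ≠ targetBits x' := by
    rw [targetBits_eq _ hm_nc K h3 hα, targetBits_eq x' hm'_nc K' h3' hα',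
      bitsOf_eq_of_length_eq hlen'.symm]
    intro h
    have hltK := classNumber_lt_window (encodeNat (2 * q)) K h3 hm_nc hα
    have hltK' := classNumber_lt_window x' K' h3' hm'_nc hα'
    rw [← hlen'] at hltK
    unfold bitsOf at h
    exact hne (eq_of_testBit_eq_of_lt hltK hltK' (List.ofFn_injective h))
  -- and one of the two inputs defeats `A`
  by_cases hxA : A.pr id (encodeNat (2 * q)) {targetBits (encodeNat (2 * q))} < 2 / 3
  · exact ⟨encodeNat (2 * q), by omega, hm_nc, hxA⟩
  · refine ⟨x', by rw [hlen']; omega, hm'_nc, ?_⟩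
    have hsum := pr_add_pr_le_one A (encodeNat (2 * q)) hT
    rw [← hbl]
    have hge := not_lt.mp hxA
    linarith

/-- **Composition** (kernel-checked): the three stubs give the crux BY NAME — the two arithmetic stubs
give the rung (`fiftyBlindBitsRung_of_stubs`), the climb reaches the top of the family, and the top is
the crux (`LadderDown.juntaRung_id_iff`). -/
theorem PureCubicClassNumberHard_of (hg : Registered.stub_genus) (hr : Registered.stub_reach)
    (hc : Registered.stub_climb) : PureCubicClassNumberHard :=
  juntaRung_id_iff.mp (hc (fiftyBlindBitsRung_of_stubs hg hr))

/-- Wiring check: the sorried stub theorems feed `PureCubicClassNumberHard_of` as stated (the aliases are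
definitionally the stub statements).  An unnamed `example`, so that `PureCubicClassNumberHard_of` stays the
ONLY declaration of this module concluding the crux by name. -/
example : PureCubicClassNumberHard := PureCubicClassNumberHard_of stub_genus stub_reach stub_climb

end Summit.QuantumAdvantage.QuantumAdvantage.Cruxes.PureCubicClassNumberHard.JuntaLadder

/-!
# PART I-b — `LadderDown` (continued): family A (conditional calibration)

Kept apart from PART I for readability; no declaration here concludes the crux by head symbol (the only such
declaration of the module is `JuntaLadder.PureCubicClassNumberHard_of`, skeleton-checker convention).  Family A is BANKED CONTEXT only
(its next rung's leaf implies the summit, `ReExam.factoringType_leaf`; see the LADDER write-up §3).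
-/

namespace Summit.QuantumAdvantage.QuantumAdvantage.Cruxes.PureCubicClassNumberHard.LadderDown

open Summit.QuantumAdvantage.QuantumAdvantage.Theses.LinnikCubicClassGroups
open Summit.QuantumAdvantage.QuantumAdvantage.Theorems (PhiHidingThree pureCubicClassNumberHard_of_phiHidingThree)
open Summit.QuantumAdvantage.QuantumAdvantage.Cruxes.PureCubicClassNumberHard.ReExam (RSASplitHard)

/-! ## Family A: conditional calibration -/

/-- **RUNG FAMILY** `CalibrationRung H := H → X` (antitone in the strength of `H`). -/
def CalibrationRung (H : Prop) : Prop := H → PureCubicClassNumberHard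

theorem calibrationRung_anti {H H' : Prop} (hH : H' → H) (h : CalibrationRung H) :
    CalibrationRung H' := fun h' => h (hH h')

/-- **FLOOR, landed**: `Φ`-hiding at `e = 3` implies the crux (`p133220`). -/
theorem calibrationRung_floor : CalibrationRung PhiHidingThree :=
  pureCubicClassNumberHard_of_phiHidingThree

/-- **NEXT RUNG** (census D2, card `ramified-cubes-factoring-transfer`): RSA-splitting hardness and
degree-one generation imply the crux — the GRH-free Shanks–Schoof transfer for maximal pure-cubic
orders.  Its leaf `RSASplitHard` implies the summit alone (`ReExam.factoringType_leaf`). -/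
def RSACalibration : Prop := CalibrationRung (RSASplitHard ∧ DegreeOnePrimesEscape)

/-- ON-PATH: the crux implies the rung trivially. -/
theorem rsaCalibration_of_crux (h : PureCubicClassNumberHard) : RSACalibration := fun _ => h

end Summit.QuantumAdvantage.QuantumAdvantage.Cruxes.PureCubicClassNumberHard.LadderDown

/-!
# PART III — `JuntaLadder.Special`: compiled witnesses for the rung `LadderDown.FiftyBlindBitsRung`

Forward generator G4 (ladder-down) on crux `PureCubicClassNumberHard` (stmt-QuantumAdvantage-11826).

* FLOOR of the family `JuntaRung j` at `j = 0` is a THEOREM: `LadderDown.juntaRung_zero`, PART I above (every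
  length-oblivious PPT algorithm — one reading nothing but `|x|` — fails at every length `3k+6`, on one of
  the two non-cubes `54·8^k`, `56·8^k`, whose class-number windows differ: `h(ℚ(∛2)) = 1 ≠ h(ℚ(∛7))`).
* The rung SPECIALISES to its floor (`juntaRung_zero_of_fiftyBlindBitsRung`, antitonicity in `j`).
* ON-PATH: the crux implies the rung (`fiftyBlindBitsRung_of_crux`), and the top of the family IS the
  crux (`juntaRung_id_iff`).
No `sorry` in this part.
-/

namespace Summit.QuantumAdvantage.QuantumAdvantage.Cruxes.PureCubicClassNumberHard.JuntaLadder.Special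

open Summit.QuantumAdvantage.QuantumAdvantage.Theses.LinnikCubicClassGroups (PureCubicClassNumberHard)
open Summit.QuantumAdvantage.QuantumAdvantage.Cruxes.PureCubicClassNumberHard.LadderDown

/-- witness (floor `j = 0`, PROVED in `LadderDown.lean`). -/
theorem floor_proved : JuntaRung (fun _ => 0) := juntaRung_zero

/-- the rung specialises to the floor parameters. -/
theorem rung_specialises_to_floor : FiftyBlindBitsRung → JuntaRung (fun _ => 0) :=
  juntaRung_zero_of_fiftyBlindBitsRung

/-- on-path: the crux implies the rung. -/
theorem rung_of_crux : PureCubicClassNumberHard → FiftyBlindBitsRung := fiftyBlindBitsRung_of_crux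

/-- the next rung up (`j n = n - 1`) implies this one. -/
theorem rung_of_next : OneBlindBitRung → FiftyBlindBitsRung := fiftyBlindBitsRung_of_oneBlindBitRung

/-- the top of the family is the crux itself. -/
theorem top_iff_crux : JuntaRung (fun n => n) ↔ PureCubicClassNumberHard := juntaRung_id_iff

end Summit.QuantumAdvantage.QuantumAdvantage.Cruxes.PureCubicClassNumberHard.JuntaLadder.Special
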